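import Summits.MatrixMultiplication.OmegaCensus.STPPSmallPatternKernelProduct

/-!
# ω-census, `(2,1,1)^5` is infeasible in `ℤ/2 × ℤ/2 × ℤ/5` — kernel search, part 3 of 4

HONEST FRAMING (pub-omega census; verbatim): lottery ticket; floor = certified bounds/negative ranges.
Census STRUCTURE bookkeeping of the STPP track (seat pub-omega-stpp-3, gen 23; STRUCTURE row B5, the threshold column
`T1(H) = max {k : (2,1,1)^k ⊆ H}`, lower side), not progress on `ω`: small patterns in small groups bound no exponent.

Chunks of the kernel mask search `STPP211Neg.search (prodGC 2 (prodGC 2 (zcode 5))) 5` (`decide +kernel`; ≈ 111 s of kernel time predicted);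
assembled in `STPPSmallPatternNone211K5P2x2x5.lean`.

References: H. Cohn, R. Kleinberg, B. Szegedy, C. Umans, FOCS 2005 (arXiv:math/0511460), Def. 5.1.  Record: pub-omega HOME
`pub-omega-stpp-3-g23/` (plans `py/cells/*.json` from the Python mirror `k211v3.py`; engine cross-checks: lister2 (gen 22),
gen211.c (gen 21) — COMPLETE NONE on these cells; not used by the proofs).
-/

set_option Elab.async false  -- several kernel pieces: elaborate sequentially (memory)

namespace Summit.MatrixMultiplication.OmegaCensus

namespace STPP211Neg

/-- Chunk list 6 of `ℤ/2 × ℤ/2 × ℤ/5`, `k = 5` (entries `(d, x1)`: code of the representative `d` of `A₀ = {0,d}`, first-level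
exclusion mask; 392185 mask translations in the mirror ≈ 49 s predicted). -/
def P2_2_5k5.ch6 : List (ℕ × ℕ) := [(11, 0)]

/-- Kernel search over chunk list 6 of `ℤ/2 × ℤ/2 × ℤ/5`, `k = 5`. -/
theorem P2_2_5k5.s6 : search (prodGC 2 (prodGC 2 (zcode 5))) 5 P2_2_5k5.ch6 = true := by
  decide +kernel

/-- Chunk list 7 of `ℤ/2 × ℤ/2 × ℤ/5`, `k = 5` (entries `(d, x1)`: code of the representative `d` of `A₀ = {0,d}`, first-level
exclusion mask; 435120 mask translations in the mirror ≈ 54 s predicted). -/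
def P2_2_5k5.ch7 : List (ℕ × ℕ) := [(15, 1048065)]

/-- Kernel search over chunk list 7 of `ℤ/2 × ℤ/2 × ℤ/5`, `k = 5`. -/
theorem P2_2_5k5.s7 : search (prodGC 2 (prodGC 2 (zcode 5))) 5 P2_2_5k5.ch7 = true := by
  decide +kernel

/-- Chunk list 8 of `ℤ/2 × ℤ/2 × ℤ/5`, `k = 5` (entries `(d, x1)`: code of the representative `d` of `A₀ = {0,d}`, first-level
exclusion mask; 65248 mask translations in the mirror ≈ 8 s predicted). -/
def P2_2_5k5.ch8 : List (ℕ × ℕ) := [(15, 511)]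

/-- Kernel search over chunk list 8 of `ℤ/2 × ℤ/2 × ℤ/5`, `k = 5`. -/
theorem P2_2_5k5.s8 : search (prodGC 2 (prodGC 2 (zcode 5))) 5 P2_2_5k5.ch8 = true := by
  decide +kernel

end STPP211Neg

end Summit.MatrixMultiplication.OmegaCensus
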